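import Mathlib
import Summits.ValiantsHypothesis.ValiantsHypothesis.Theorems.BarrierLeverPartitionMinorsHitByVPHiddenStatesSecondShellEqualBlocked
import Summits.ValiantsHypothesis.ValiantsHypothesis.Theorems.BarrierLeverPartitionMinorsHitByVPHiddenStatesSecondShellUnfedChain
import Summits.ValiantsHypothesis.ValiantsHypothesis.Theorems.BarrierLeverPartitionMinorsHitByVPHiddenStatesSecondShellAnyHCells
import Summits.ValiantsHypothesis.ValiantsHypothesis.Theorems.BarrierLeverPartitionMinorsHitByVPHiddenStatesSecondShellTwoTops
import Summits.ValiantsHypothesis.ValiantsHypothesis.Theorems.BarrierLeverPartitionMinorsHitByVPHiddenStatesSecondShellEqualY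

/-!
# Route BarrierLever — item `PartitionMinorsHitByVP` (stmt-ValiantsHypothesis-19717), line `hidden-states`:
# ★★★ THE WHOLE SECOND SHELL OF EVERY BALL IS SERVED — `B_t(h) ∖ {A₁, A₂} ∪ {C₁, C₂}` for ALL `t, h`

Helper file (`--supports stmt-ValiantsHypothesis-19717`; cell valiant-natproofs, 𝒟-side door (c), registered line
`Cruxes/PartitionMinorsHitByVP/Lines/hidden_states.lean` v9; prover seat val-np-p6 gen 20).  Closes NO item; definition-free.

THE THEOREM (memo HOME/val-np-p6/g20/MEMO-valnp6-g20.md §1; Conjecture S2‴ of gens 17–19, now a theorem).  For EVERY `h, t` and all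
`A₁ ≠ A₂` of size `t`, `C₁ ≠ C₂` of size `t + 1` with `A_i ⊄ C_j` (so that `𝒰 = B_t(h) ∖ {A₁, A₂} ∪ {C₁, C₂}` is a down-set of size
`|B_t(h)|` — the whole SECOND SHELL of the ball), every injective row family ranging in `𝒰` whose columns cover `B_t(h)` is served by a table:
★★★ `exists_table_secondShell` — NO further hypothesis.  PROOF = the eight-cell decomposition by the sixteen membership types
`(∈A₁, ∈C₁, ∈A₂, ∈C₂)` of a coordinate, each cell a landed ∀`t,h` theorem applied to one of the four symmetric frames
(swap `1 ↔ 2`; swap `C₁ ↔ C₂`): an immobile outside token (`…AnyHCells.exists_table_secondShell_CT_anyH`, types 0011/1100/0110/1001) ·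
two tops (`…TwoTops`, types 0100∧1101 etc.) · blocked bottom (`…BlockedBottom`, a common node 0101 with 0001∧0010 or 0100∧1000 or
0111∧1011 or 1101∧1110) · equal paths (`…EqualBlocked` for `|Y| ≥ 4`, gen 17's cyclic `…EqualY` for `|Y| = 3`) · unfed chains
(`…UnfedChain.exists_table_secondShell_unfed₁/₂`).  The decision tree is verified complete by hand below and by machine for every class of
every `h` with `t ≤ 9` (kit j326809: 1 473 378 classes at `t = 9`, 0 uncovered).

WHAT THIS IS / IS NOT: the second shell (swap distance 2 from the ball) of the conjecture column (GC½ / S2) is now kernel for all `t, h`;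
it is NOT the registered node `stub_simplexPairLower` (all down-sets), 19717 stays OPEN; nothing on crux 14610 or VP ≠ VNP.
-/

set_option linter.dupNamespace false

namespace Summit.ValiantsHypothesis.ValiantsHypothesis.Theorems.BarrierLever.HiddenStates

open Finset

noncomputable section

namespace SecondShell

open PathTable

/-- two finsets of equal size that differ: the first has an element outside the second. -/
theorem exists_mem_not_mem_of_card_eq {α : Type} [DecidableEq α] {A B : Finset α} (hcard : A.card = B.card) (hne : A ≠ B) :
    ∃ v, v ∈ A ∧ v ∉ B := by
  by_contra hcon
  push Not at hcon
  exact hne (Finset.eq_of_subset_of_card_le (fun v hv => hcon v hv) (le_of_eq hcard.symm))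

/-- the path of a swap has a node other than any given coordinate. -/
theorem exists_path_node_ne {α : Type} [DecidableEq α] {A C : Finset α} {t : ℕ} (hA : A.card = t) (hC : C.card = t + 1)
    (hAC : ¬ A ⊆ C) (y : α) : ∃ p, p ∈ C ∧ p ∉ A ∧ p ≠ y := by
  have h2 : 2 ≤ (C \ A).card := by
    have hlt : (A ∩ C).card < A.card := by
      refine Finset.card_lt_card ⟨Finset.inter_subset_left, fun h' => hAC ?_⟩
      exact fun x hx => (Finset.mem_inter.1 (h' hx)).2
    have := Finset.card_sdiff_add_card_inter C A
    rw [Finset.inter_comm] at this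
    omega
  obtain ⟨a, ha, b, hb, hab⟩ := Finset.one_lt_card.1 (by omega : 1 < (C \ A).card)
  rw [Finset.mem_sdiff] at ha hb
  by_cases hay : a = y
  · exact ⟨b, hb.1, hb.2, fun h => hab (hay.trans h.symm)⟩
  · exact ⟨a, ha.1, ha.2, hay⟩

set_option maxHeartbeats 1600000 in
/-- ★★★ **THE WHOLE SECOND SHELL OF EVERY BALL IS SERVED.**  For all `h, t`, all `A₁ ≠ A₂` of size `t` and `C₁ ≠ C₂` of size `t + 1`
with `A_i ⊄ C_j`, every injective row family in `B_t(h) ∖ {A₁, A₂} ∪ {C₁, C₂}` with columns covering `B_t(h)` is served by a table. -/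
theorem exists_table_secondShell (h t : ℕ) (A₁ A₂ C₁ C₂ : Finset (Fin h))
    (hA₁ : A₁.card = t) (hA₂ : A₂.card = t) (hC₁ : C₁.card = t + 1) (hC₂ : C₂.card = t + 1)
    (h₁₁ : ¬ A₁ ⊆ C₁) (h₂₂ : ¬ A₂ ⊆ C₂) (h₁₂ : ¬ A₁ ⊆ C₂) (h₂₁ : ¬ A₂ ⊆ C₁) (hA : A₁ ≠ A₂) (hC : C₁ ≠ C₂)
    {r : ℕ} (u cols : Fin r → Finset (Fin h)) (hu : Function.Injective u)
    (hU : ∀ i, ((u i).card ≤ t ∧ u i ≠ A₁ ∧ u i ≠ A₂) ∨ u i = C₁ ∨ u i = C₂)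
    (hcols : ∀ J : Finset (Fin h), J.card ≤ t → ∃ kk, cols kk = J) :
    ∃ tx : Option (Fin h) → Fin h → ℂ,
      (Matrix.of fun i kk : Fin r => ∏ a ∈ u i, (tx none a + ∑ q ∈ cols kk, tx (some q) a)).det ≠ 0 := by
  classical
  -- the row hypothesis in the three other frames
  have hU_S : ∀ i, ((u i).card ≤ t ∧ u i ≠ A₂ ∧ u i ≠ A₁) ∨ u i = C₂ ∨ u i = C₁ := by
    intro i; rcases hU i with ⟨h1, h2, h3⟩ | h' | h'
    · exact Or.inl ⟨h1, h3, h2⟩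
    · exact Or.inr (Or.inr h')
    · exact Or.inr (Or.inl h')
  have hU_M : ∀ i, ((u i).card ≤ t ∧ u i ≠ A₁ ∧ u i ≠ A₂) ∨ u i = C₂ ∨ u i = C₁ := by
    intro i; rcases hU i with h' | h' | h'
    · exact Or.inl h'
    · exact Or.inr (Or.inr h')
    · exact Or.inr (Or.inl h')
  have hU_SM : ∀ i, ((u i).card ≤ t ∧ u i ≠ A₂ ∧ u i ≠ A₁) ∨ u i = C₁ ∨ u i = C₂ := by
    intro i; rcases hU i with ⟨h1, h2, h3⟩ | h' | h'
    · exact Or.inl ⟨h1, h3, h2⟩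
    · exact Or.inr (Or.inl h')
    · exact Or.inr (Or.inr h')
  -- 0. immobile outside tokens (types 0011, 1100, 0110, 1001)
  by_cases hCT₁ : ∃ z, z ∈ A₂ ∧ z ∈ C₂ ∧ z ∉ A₁ ∧ z ∉ C₁
  · exact exists_table_secondShell_CT_anyH h t A₁ A₂ C₁ C₂ hA₁ hA₂ hC₁ hC₂ h₁₁ h₂₂ hA hC hCT₁ u cols hu hU hcols
  by_cases hCT₂ : ∃ z, z ∈ A₁ ∧ z ∈ C₁ ∧ z ∉ A₂ ∧ z ∉ C₂
  · exact exists_table_secondShell_CT_anyH h t A₂ A₁ C₂ C₁ hA₂ hA₁ hC₂ hC₁ h₂₂ h₁₁ hA.symm hC.symm hCT₂ u cols hu hU_S hcols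
  by_cases hP : ∃ z, z ∈ A₂ ∧ z ∈ C₁ ∧ z ∉ A₁ ∧ z ∉ C₂
  · exact exists_table_secondShell_CT_anyH h t A₁ A₂ C₂ C₁ hA₁ hA₂ hC₂ hC₁ h₁₂ h₂₁ hA hC.symm hP u cols hu hU_M hcols
  by_cases hQ : ∃ z, z ∈ A₁ ∧ z ∈ C₂ ∧ z ∉ A₂ ∧ z ∉ C₁
  · exact exists_table_secondShell_CT_anyH h t A₂ A₁ C₁ C₂ hA₂ hA₁ hC₁ hC₂ h₂₁ h₁₂ hA.symm hC hQ u cols hu hU_SM hcols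
  have hCT₁' : ∀ z, z ∈ A₂ → z ∈ C₂ → z ∉ A₁ → z ∉ C₁ → False := fun z h1 h2 h3 h4 => hCT₁ ⟨z, h1, h2, h3, h4⟩
  have hCT₂' : ∀ z, z ∈ A₁ → z ∈ C₁ → z ∉ A₂ → z ∉ C₂ → False := fun z h1 h2 h3 h4 => hCT₂ ⟨z, h1, h2, h3, h4⟩
  have hP' : ∀ z, z ∈ A₂ → z ∈ C₁ → z ∉ A₁ → z ∉ C₂ → False := fun z h1 h2 h3 h4 => hP ⟨z, h1, h2, h3, h4⟩
  have hQ' : ∀ z, z ∈ A₁ → z ∈ C₂ → z ∉ A₂ → z ∉ C₁ → False := fun z h1 h2 h3 h4 => hQ ⟨z, h1, h2, h3, h4⟩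
  -- no connector coordinates, in all frames
  have hpq₁ : Disjoint (C₁ \ A₁) (A₂ \ C₂) := by
    rw [Finset.disjoint_left]; intro v hv hv'
    rw [Finset.mem_sdiff] at hv hv'; exact hP' v hv'.1 hv.1 hv.2 hv'.2
  have hpq₂ : Disjoint (A₁ \ C₁) (C₂ \ A₂) := by
    rw [Finset.disjoint_left]; intro v hv hv'
    rw [Finset.mem_sdiff] at hv hv'; exact hQ' v hv.1 hv'.1 hv'.2 hv.2
  have hct₁ : Disjoint (C₁ \ A₂) (A₁ \ C₂) := by
    rw [Finset.disjoint_left]; intro v hv hv'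
    rw [Finset.mem_sdiff] at hv hv'; exact hCT₂' v hv'.1 hv.1 hv.2 hv'.2
  have hct₂ : Disjoint (A₂ \ C₁) (C₂ \ A₁) := by
    rw [Finset.disjoint_left]; intro v hv hv'
    rw [Finset.mem_sdiff] at hv hv'; exact hCT₁' v hv.1 hv'.1 hv'.2 hv.2
  -- witnesses of `A₁ ≠ A₂` and `C₁ ≠ C₂`
  obtain ⟨vx, hvx₁, hvx₂⟩ := exists_mem_not_mem_of_card_eq (hA₁.trans hA₂.symm) hA        -- `vx ∈ A₁ ∖ A₂`
  obtain ⟨vy, hvy₁, hvy₂⟩ := exists_mem_not_mem_of_card_eq (hA₂.trans hA₁.symm) hA.symm   -- `vy ∈ A₂ ∖ A₁`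
  obtain ⟨vd, hvd₁, hvd₂⟩ := exists_mem_not_mem_of_card_eq (hC₁.trans hC₂.symm) hC        -- `vd ∈ C₁ ∖ C₂`
  obtain ⟨va, hva₁, hva₂⟩ := exists_mem_not_mem_of_card_eq (hC₂.trans hC₁.symm) hC.symm   -- `va ∈ C₂ ∖ C₁`
  -- 1. a common path node `b₁` (type 0101)?
  by_cases hb : ∃ b, b ∈ C₁ ∧ b ∉ A₁ ∧ b ∈ C₂ ∧ b ∉ A₂
  · obtain ⟨b₁, hb₁, hb₂, hb₃, hb₄⟩ := hb
    have hbY₁ : b₁ ∈ C₁ \ A₁ := Finset.mem_sdiff.2 ⟨hb₁, hb₂⟩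
    have hbY₂ : b₁ ∈ C₂ \ A₂ := Finset.mem_sdiff.2 ⟨hb₃, hb₄⟩
    -- 1(i)–(iv): blocked bottom with a dead attachment
    by_cases hiy : (∃ a, a ∉ A₁ ∧ a ∉ C₁ ∧ a ∉ A₂ ∧ a ∈ C₂) ∧ (∃ y, y ∉ A₁ ∧ y ∉ C₁ ∧ y ∈ A₂ ∧ y ∉ C₂)
    · obtain ⟨⟨a, ha₁, ha₂, ha₃, ha₄⟩, ⟨y, hy₁, hy₂, hy₃, hy₄⟩⟩ := hiy
      exact exists_table_secondShell_blockedBottom h t A₂ A₁ C₂ C₁ hA₂ hA₁ hC₂ hC₁ h₂₂ h₁₁ hA.symm hC.symm hpq₂.symm hpq₁.symm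
        hbY₂ hbY₁ (Finset.mem_sdiff.2 ⟨ha₄, ha₃⟩) (fun h' => ha₂ (Finset.mem_sdiff.1 h').1)
        (fun h' => (h' ▸ ha₂) hb₁) (Finset.mem_sdiff.2 ⟨hy₃, hy₄⟩) (Or.inr ⟨ha₁, hy₁⟩) u cols hu hU_S hcols
    by_cases hix : (∃ d, d ∉ A₁ ∧ d ∈ C₁ ∧ d ∉ A₂ ∧ d ∉ C₂) ∧ (∃ x, x ∈ A₁ ∧ x ∉ C₁ ∧ x ∉ A₂ ∧ x ∉ C₂)
    · obtain ⟨⟨d, hd₁, hd₂, hd₃, hd₄⟩, ⟨x, hx₁, hx₂, hx₃, hx₄⟩⟩ := hix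
      exact exists_table_secondShell_blockedBottom h t A₁ A₂ C₁ C₂ hA₁ hA₂ hC₁ hC₂ h₁₁ h₂₂ hA hC hpq₁ hpq₂
        hbY₁ hbY₂ (Finset.mem_sdiff.2 ⟨hd₂, hd₁⟩) (fun h' => hd₄ (Finset.mem_sdiff.1 h').1)
        (fun h' => (h' ▸ hd₄) hb₃) (Finset.mem_sdiff.2 ⟨hx₁, hx₂⟩) (Or.inr ⟨hd₃, hx₃⟩) u cols hu hU hcols
    by_cases hdy : (∃ d, d ∉ A₁ ∧ d ∈ C₁ ∧ d ∉ A₂ ∧ d ∉ C₂) ∧ (∃ y, y ∉ A₁ ∧ y ∉ C₁ ∧ y ∈ A₂ ∧ y ∉ C₂)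
    · obtain ⟨⟨d, hd₁, hd₂, hd₃, hd₄⟩, ⟨y, hy₁, hy₂, hy₃, hy₄⟩⟩ := hdy
      exact exists_table_secondShell_blockedBottom h t A₂ A₁ C₁ C₂ hA₂ hA₁ hC₁ hC₂ h₂₁ h₁₂ hA.symm hC hct₁ hct₂
        (Finset.mem_sdiff.2 ⟨hb₁, hb₄⟩) (Finset.mem_sdiff.2 ⟨hb₃, hb₂⟩) (Finset.mem_sdiff.2 ⟨hd₂, hd₃⟩)
        (fun h' => hd₄ (Finset.mem_sdiff.1 h').1) (fun h' => (h' ▸ hd₄) hb₃) (Finset.mem_sdiff.2 ⟨hy₃, hy₂⟩)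
        (Or.inr ⟨hd₁, hy₁⟩) u cols hu hU_SM hcols
    by_cases hax : (∃ a, a ∉ A₁ ∧ a ∉ C₁ ∧ a ∉ A₂ ∧ a ∈ C₂) ∧ (∃ x, x ∈ A₁ ∧ x ∉ C₁ ∧ x ∉ A₂ ∧ x ∉ C₂)
    · obtain ⟨⟨a, ha₁, ha₂, ha₃, ha₄⟩, ⟨x, hx₁, hx₂, hx₃, hx₄⟩⟩ := hax
      exact exists_table_secondShell_blockedBottom h t A₁ A₂ C₂ C₁ hA₁ hA₂ hC₂ hC₁ h₁₂ h₂₁ hA hC.symm hct₂.symm hct₁.symm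
        (Finset.mem_sdiff.2 ⟨hb₃, hb₂⟩) (Finset.mem_sdiff.2 ⟨hb₁, hb₄⟩) (Finset.mem_sdiff.2 ⟨ha₄, ha₁⟩)
        (fun h' => ha₂ (Finset.mem_sdiff.1 h').1) (fun h' => (h' ▸ ha₂) hb₁) (Finset.mem_sdiff.2 ⟨hx₁, hx₄⟩)
        (Or.inr ⟨ha₃, hx₃⟩) u cols hu hU_M hcols
    -- 1(v)–(viii): blocked bottom with an immobile token
    by_cases hcz : (∃ c, c ∉ A₁ ∧ c ∈ C₁ ∧ c ∈ A₂ ∧ c ∈ C₂) ∧ (∃ z, z ∈ A₁ ∧ z ∉ C₁ ∧ z ∈ A₂ ∧ z ∈ C₂)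
    · obtain ⟨⟨c, hc₁, hc₂, hc₃, hc₄⟩, ⟨z, hz₁, hz₂, hz₃, hz₄⟩⟩ := hcz
      exact exists_table_secondShell_blockedBottom h t A₁ A₂ C₁ C₂ hA₁ hA₂ hC₁ hC₂ h₁₁ h₂₂ hA hC hpq₁ hpq₂
        hbY₁ hbY₂ (Finset.mem_sdiff.2 ⟨hc₂, hc₁⟩) (fun h' => (Finset.mem_sdiff.1 h').2 hc₃)
        (fun h' => hb₄ (h' ▸ hc₃)) (Finset.mem_sdiff.2 ⟨hz₁, hz₂⟩) (Or.inl ⟨hc₄, hz₄⟩) u cols hu hU hcols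
    by_cases hez' : (∃ e, e ∈ A₁ ∧ e ∈ C₁ ∧ e ∉ A₂ ∧ e ∈ C₂) ∧ (∃ z, z ∈ A₁ ∧ z ∈ C₁ ∧ z ∈ A₂ ∧ z ∉ C₂)
    · obtain ⟨⟨e, he₁, he₂, he₃, he₄⟩, ⟨z, hz₁, hz₂, hz₃, hz₄⟩⟩ := hez'
      exact exists_table_secondShell_blockedBottom h t A₂ A₁ C₂ C₁ hA₂ hA₁ hC₂ hC₁ h₂₂ h₁₁ hA.symm hC.symm hpq₂.symm hpq₁.symm
        hbY₂ hbY₁ (Finset.mem_sdiff.2 ⟨he₄, he₃⟩) (fun h' => (Finset.mem_sdiff.1 h').2 he₁)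
        (fun h' => hb₂ (h' ▸ he₁)) (Finset.mem_sdiff.2 ⟨hz₃, hz₄⟩) (Or.inl ⟨he₂, hz₂⟩) u cols hu hU_S hcols
    by_cases hcz' : (∃ c, c ∉ A₁ ∧ c ∈ C₁ ∧ c ∈ A₂ ∧ c ∈ C₂) ∧ (∃ z, z ∈ A₁ ∧ z ∈ C₁ ∧ z ∈ A₂ ∧ z ∉ C₂)
    · obtain ⟨⟨c, hc₁, hc₂, hc₃, hc₄⟩, ⟨z, hz₁, hz₂, hz₃, hz₄⟩⟩ := hcz'
      exact exists_table_secondShell_blockedBottom h t A₁ A₂ C₂ C₁ hA₁ hA₂ hC₂ hC₁ h₁₂ h₂₁ hA hC.symm hct₂.symm hct₁.symm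
        (Finset.mem_sdiff.2 ⟨hb₃, hb₂⟩) (Finset.mem_sdiff.2 ⟨hb₁, hb₄⟩) (Finset.mem_sdiff.2 ⟨hc₄, hc₁⟩)
        (fun h' => (Finset.mem_sdiff.1 h').2 hc₃) (fun h' => hb₄ (h' ▸ hc₃)) (Finset.mem_sdiff.2 ⟨hz₁, hz₄⟩)
        (Or.inl ⟨hc₂, hz₂⟩) u cols hu hU_M hcols
    by_cases hez : (∃ e, e ∈ A₁ ∧ e ∈ C₁ ∧ e ∉ A₂ ∧ e ∈ C₂) ∧ (∃ z, z ∈ A₁ ∧ z ∉ C₁ ∧ z ∈ A₂ ∧ z ∈ C₂)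
    · obtain ⟨⟨e, he₁, he₂, he₃, he₄⟩, ⟨z, hz₁, hz₂, hz₃, hz₄⟩⟩ := hez
      exact exists_table_secondShell_blockedBottom h t A₂ A₁ C₁ C₂ hA₂ hA₁ hC₁ hC₂ h₂₁ h₁₂ hA.symm hC hct₁ hct₂
        (Finset.mem_sdiff.2 ⟨hb₁, hb₄⟩) (Finset.mem_sdiff.2 ⟨hb₃, hb₂⟩) (Finset.mem_sdiff.2 ⟨he₂, he₃⟩)
        (fun h' => (Finset.mem_sdiff.1 h').2 he₁) (fun h' => hb₂ (h' ▸ he₁)) (Finset.mem_sdiff.2 ⟨hz₃, hz₂⟩)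
        (Or.inl ⟨he₄, hz₄⟩) u cols hu hU_SM hcols
    -- 1(ix): no node outside the common path ⇒ equal paths
    by_cases hEQ : (∀ v, ¬ (v ∉ A₁ ∧ v ∉ C₁ ∧ v ∉ A₂ ∧ v ∈ C₂)) ∧ (∀ v, ¬ (v ∉ A₁ ∧ v ∈ C₁ ∧ v ∉ A₂ ∧ v ∉ C₂)) ∧
        (∀ v, ¬ (v ∉ A₁ ∧ v ∈ C₁ ∧ v ∈ A₂ ∧ v ∈ C₂)) ∧ (∀ v, ¬ (v ∈ A₁ ∧ v ∈ C₁ ∧ v ∉ A₂ ∧ v ∈ C₂))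
    · obtain ⟨hna, hnd, hnc, hne⟩ := hEQ
      have hY : C₁ \ A₁ = C₂ \ A₂ := by
        ext v; simp only [Finset.mem_sdiff]
        constructor
        · rintro ⟨hvC₁, hvA₁⟩
          by_cases hvA₂ : v ∈ A₂
          · by_cases hvC₂ : v ∈ C₂
            · exact (hnc v ⟨hvA₁, hvC₁, hvA₂, hvC₂⟩).elim
            · exact (hP' v hvA₂ hvC₁ hvA₁ hvC₂).elim
          · by_cases hvC₂ : v ∈ C₂
            · exact ⟨hvC₂, hvA₂⟩
            · exact (hnd v ⟨hvA₁, hvC₁, hvA₂, hvC₂⟩).elim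
        · rintro ⟨hvC₂, hvA₂⟩
          by_cases hvA₁ : v ∈ A₁
          · by_cases hvC₁ : v ∈ C₁
            · exact (hne v ⟨hvA₁, hvC₁, hvA₂, hvC₂⟩).elim
            · exact (hQ' v hvA₁ hvC₂ hvA₂ hvC₁).elim
          · by_cases hvC₁ : v ∈ C₁
            · exact ⟨hvC₁, hvA₁⟩
            · exact (hna v ⟨hvA₁, hvC₁, hvA₂, hvC₂⟩).elim
      -- `vy ∈ A₂ ∖ A₁` is of type 0010, `vx ∈ A₁ ∖ A₂` of type 1000, `va ∈ C₂ ∖ C₁` of type 1011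
      have hvyC₁ : vy ∉ C₁ := fun h' => by
        by_cases hvyC₂ : vy ∈ C₂
        · exact hnc vy ⟨hvy₂, h', hvy₁, hvyC₂⟩
        · exact hP' vy hvy₁ h' hvy₂ hvyC₂
      have hvyC₂ : vy ∉ C₂ := fun h' => hCT₁' vy hvy₁ h' hvy₂ hvyC₁
      have hvxC₂ : vx ∉ C₂ := fun h' => by
        by_cases hvxC₁ : vx ∈ C₁
        · exact hne vx ⟨hvx₁, hvxC₁, hvx₂, h'⟩
        · exact hQ' vx hvx₁ h' hvx₂ hvxC₁
      have hvxC₁ : vx ∉ C₁ := fun h' => hCT₂' vx hvx₁ h' hvx₂ hvxC₂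
      have hvaA₁ : va ∈ A₁ := by
        by_contra h'
        by_cases hvaA₂ : va ∈ A₂
        · exact hCT₁' va hvaA₂ hva₁ h' hva₂
        · exact hna va ⟨h', hva₂, hvaA₂, hva₁⟩
      have hvaA₂ : va ∈ A₂ := by
        by_contra h'
        exact hQ' va hvaA₁ hva₁ h' hva₂
      by_cases h4 : 4 ≤ (C₁ \ A₁).card
      · exact exists_table_secondShell_equalBlocked h t A₁ A₂ C₁ C₂ hA₁ hA₂ hC₁ hC₂ h₁₁ h₂₂ hA hC hY h4
          hvaA₁ hva₂ hvaA₂ hva₁ hvy₂ hvyC₁ hvy₁ hvyC₂ u cols hu hU hcols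
      · -- `|Y| = 3`: the cyclic equal-Y cell
        obtain ⟨k, j₁, j₁', hk₁, hkj₁, a1, a2, -, -⟩ := swap_sizes A₁ C₁ hA₁ hC₁ h₁₁
        obtain ⟨k₂, j₂, j₂', hk₂, hkj₂, c1, c2, -, -⟩ := swap_sizes A₂ C₂ hA₂ hC₂ h₂₂
        have hxz : va ≠ vx := fun h' => hvx₂ (h' ▸ hvaA₂)
        have hsub : ({va, vx} : Finset (Fin h)) ⊆ A₁ \ C₁ := by
          intro w hw
          rcases Finset.mem_insert.1 hw with rfl | hw
          · exact Finset.mem_sdiff.2 ⟨hvaA₁, hva₂⟩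
          · rw [Finset.mem_singleton] at hw; rw [hw]; exact Finset.mem_sdiff.2 ⟨hvx₁, hvxC₁⟩
        have hk2 : k = 2 := by
          have := Finset.card_le_card hsub
          rw [Finset.card_pair hxz, a2] at this
          rw [a1] at h4; omega
        obtain rfl := hk2
        obtain rfl : k₂ = 2 := by rw [← hY, a1] at c1; omega
        have hX₁ : A₁ \ C₁ = {va, vx} :=
          (Finset.eq_of_subset_of_card_le hsub (by rw [Finset.card_pair hxz, a2])).symm
        obtain ⟨q₁, q₂, hq, hX₂⟩ := Finset.card_eq_two.1 c2
        obtain ⟨yb, yp, yq, hbp, hbq, hpq, hY₁⟩ := Finset.card_eq_three.1 a1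
        have hq₁ : q₁ ∈ A₂ := (Finset.mem_sdiff.1 (hX₂ ▸ Finset.mem_insert_self _ _ : q₁ ∈ A₂ \ C₂)).1
        have hq₂ : q₂ ∈ A₂ :=
          (Finset.mem_sdiff.1 (hX₂ ▸ Finset.mem_insert_of_mem (Finset.mem_singleton_self _) : q₂ ∈ A₂ \ C₂)).1
        exact exists_table_secondShell_equalY h t A₁ A₂ C₁ C₂ hA₁ hA₂ hC₁ hC₂ h₁₁ h₂₂ hA hC hY₁ (hY ▸ hY₁) hbp hbq hpq
          hX₁ hxz hX₂ hq hva₁ hvxC₂ (fun h' => hvx₂ (h' ▸ hq₁)) (fun h' => hvx₂ (h' ▸ hq₂)) u cols hu hU hcols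
    -- 1(x): otherwise two tops
    · -- some node outside the common path exists; then `vx`/`vy` give `e` and `c`, and no `x`, `y`, `z₁`, `z₂`
      have hc_or : (∃ a, a ∉ A₁ ∧ a ∉ C₁ ∧ a ∉ A₂ ∧ a ∈ C₂) ∨ (∃ d, d ∉ A₁ ∧ d ∈ C₁ ∧ d ∉ A₂ ∧ d ∉ C₂) ∨
          (∃ c, c ∉ A₁ ∧ c ∈ C₁ ∧ c ∈ A₂ ∧ c ∈ C₂) ∨ (∃ e, e ∈ A₁ ∧ e ∈ C₁ ∧ e ∉ A₂ ∧ e ∈ C₂) := by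
        by_contra hcon
        exact hEQ ⟨fun v hv => hcon (Or.inl ⟨v, hv⟩), fun v hv => hcon (Or.inr (Or.inl ⟨v, hv⟩)),
          fun v hv => hcon (Or.inr (Or.inr (Or.inl ⟨v, hv⟩))), fun v hv => hcon (Or.inr (Or.inr (Or.inr ⟨v, hv⟩)))⟩
      -- case A: an `a` or a `d` exists ⇒ no `x`, `y` ⇒ `vx` is an `e`, `vy` is a `c`
      have caseAD : ((∃ a, a ∉ A₁ ∧ a ∉ C₁ ∧ a ∉ A₂ ∧ a ∈ C₂) ∨ (∃ d, d ∉ A₁ ∧ d ∈ C₁ ∧ d ∉ A₂ ∧ d ∉ C₂)) →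
          (vx ∈ C₁ ∧ vx ∈ C₂) ∧ (vy ∈ C₁ ∧ vy ∈ C₂) := by
        intro had
        have hnx : ¬ (vx ∉ C₁ ∧ vx ∉ C₂) := by
          rintro ⟨h1, h2⟩
          rcases had with ha | hd
          · exact hax ⟨ha, ⟨vx, hvx₁, h1, hvx₂, h2⟩⟩
          · exact hix ⟨hd, ⟨vx, hvx₁, h1, hvx₂, h2⟩⟩
        have hny : ¬ (vy ∉ C₁ ∧ vy ∉ C₂) := by
          rintro ⟨h1, h2⟩
          rcases had with ha | hd
          · exact hiy ⟨ha, ⟨vy, hvy₂, h1, hvy₁, h2⟩⟩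
          · exact hdy ⟨hd, ⟨vy, hvy₂, h1, hvy₁, h2⟩⟩
        constructor
        · by_cases h1 : vx ∈ C₁
          · by_cases h2 : vx ∈ C₂
            · exact ⟨h1, h2⟩
            · exact (hCT₂' vx hvx₁ h1 hvx₂ h2).elim
          · by_cases h2 : vx ∈ C₂
            · exact (hQ' vx hvx₁ h2 hvx₂ h1).elim
            · exact (hnx ⟨h1, h2⟩).elim
        · by_cases h1 : vy ∈ C₁
          · by_cases h2 : vy ∈ C₂
            · exact ⟨h1, h2⟩
            · exact (hP' vy hvy₁ h1 hvy₂ h2).elim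
          · by_cases h2 : vy ∈ C₂
            · exact (hCT₁' vy hvy₁ h2 hvy₂ h1).elim
            · exact (hny ⟨h1, h2⟩).elim
      -- case B is impossible: no `a`, no `d` would leave `vd ∈ C₁ ∖ C₂` without a type
      have hAD : (∃ a, a ∉ A₁ ∧ a ∉ C₁ ∧ a ∉ A₂ ∧ a ∈ C₂) ∨ (∃ d, d ∉ A₁ ∧ d ∈ C₁ ∧ d ∉ A₂ ∧ d ∉ C₂) := by
        by_contra had
        have hnd : ∀ v, ¬ (v ∉ A₁ ∧ v ∈ C₁ ∧ v ∉ A₂ ∧ v ∉ C₂) := fun v hv => had (Or.inr ⟨v, hv⟩)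
        have hce : (∃ c, c ∉ A₁ ∧ c ∈ C₁ ∧ c ∈ A₂ ∧ c ∈ C₂) ∨ (∃ e, e ∈ A₁ ∧ e ∈ C₁ ∧ e ∉ A₂ ∧ e ∈ C₂) := by
          rcases hc_or with ha | hd | hc | he
          · exact (had (Or.inl ha)).elim
          · exact (had (Or.inr hd)).elim
          · exact Or.inl hc
          · exact Or.inr he
        by_cases hdA₁ : vd ∈ A₁
        · by_cases hdA₂ : vd ∈ A₂
          · rcases hce with hc | he
            · exact hcz' ⟨hc, ⟨vd, hdA₁, hvd₁, hdA₂, hvd₂⟩⟩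
            · exact hez' ⟨he, ⟨vd, hdA₁, hvd₁, hdA₂, hvd₂⟩⟩
          · exact hCT₂' vd hdA₁ hvd₁ hdA₂ hvd₂
        · by_cases hdA₂ : vd ∈ A₂
          · exact hP' vd hdA₂ hvd₁ hdA₁ hvd₂
          · exact hnd vd ⟨hdA₁, hvd₁, hdA₂, hvd₂⟩
      obtain ⟨⟨hxC₁, hxC₂⟩, ⟨hyC₁, hyC₂⟩⟩ := caseAD hAD
      -- two tops: `y = d` (or `a` in the other matching), `p = vy`, `y' = vx`, `p' = b₁`
      have hyb : vy ≠ b₁ := fun h' => hb₄ (h' ▸ hvy₁)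
      have hxb : b₁ ≠ vx := fun h' => hb₂ (h'.symm ▸ hvx₁)
      rcases hAD with ⟨a, ha₁, ha₂, ha₃, ha₄⟩ | ⟨d, hd₁, hd₂, hd₃, hd₄⟩
      · exact exists_table_secondShell_twoTops h t A₁ A₂ C₂ C₁ hA₁ hA₂ hC₂ hC₁ h₁₂ h₂₁ hA hC.symm
          ha₄ ha₁ ha₃ ha₂ hyC₂ hvy₂ (fun h' => ha₃ (h' ▸ hvy₁)) hxC₁ hvx₂ hvx₁ hxC₂ hb₁ hb₄ hxb hyb u cols hu hU_M hcols
      · exact exists_table_secondShell_twoTops h t A₁ A₂ C₁ C₂ hA₁ hA₂ hC₁ hC₂ h₁₁ h₂₂ hA hC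
          hd₂ hd₁ hd₃ hd₄ hyC₁ hvy₂ (fun h' => hd₃ (h' ▸ hvy₁)) hxC₂ hvx₂ hvx₁ hxC₁ hb₃ hb₄ hxb hyb u cols hu hU hcols
  · -- 2. no common path node
    have hnb : ∀ v, ¬ (v ∈ C₁ ∧ v ∉ A₁ ∧ v ∈ C₂ ∧ v ∉ A₂) := fun v hv => hb ⟨v, hv⟩
    by_cases htt : ((∃ a, a ∉ A₁ ∧ a ∉ C₁ ∧ a ∉ A₂ ∧ a ∈ C₂) ∨ (∃ d, d ∉ A₁ ∧ d ∈ C₁ ∧ d ∉ A₂ ∧ d ∉ C₂)) ∧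
        ((∃ c, c ∉ A₁ ∧ c ∈ C₁ ∧ c ∈ A₂ ∧ c ∈ C₂) ∨ (∃ e, e ∈ A₁ ∧ e ∈ C₁ ∧ e ∉ A₂ ∧ e ∈ C₂))
    · -- two tops, the two paths being disjoint
      obtain ⟨had, hce⟩ := htt
      rcases had with ⟨a, ha₁, ha₂, ha₃, ha₄⟩ | ⟨d, hd₁, hd₂, hd₃, hd₄⟩
      · rcases hce with ⟨c, hc₁, hc₂, hc₃, hc₄⟩ | ⟨e, he₁, he₂, he₃, he₄⟩
        · obtain ⟨p, hp₁, hp₂, hp₃⟩ := exists_path_node_ne hA₂ hC₂ h₂₂ a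
          obtain ⟨p', hp'₁, hp'₂, hp'₃⟩ := exists_path_node_ne hA₁ hC₁ h₁₁ c
          exact exists_table_secondShell_twoTops h t A₂ A₁ C₂ C₁ hA₂ hA₁ hC₂ hC₁ h₂₂ h₁₁ hA.symm hC.symm
            ha₄ ha₃ ha₁ ha₂ hp₁ hp₂ hp₃ hc₂ hc₁ hc₃ hc₄ hp'₁ hp'₂ hp'₃
            (by rintro rfl; exact hnb p ⟨hp'₁, hp'₂, hp₁, hp₂⟩) u cols hu hU_S hcols
        · obtain ⟨p, hp₁, hp₂, hp₃⟩ := exists_path_node_ne hA₁ hC₂ h₁₂ a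
          obtain ⟨p', hp'₁, hp'₂, hp'₃⟩ := exists_path_node_ne hA₂ hC₁ h₂₁ e
          exact exists_table_secondShell_twoTops h t A₁ A₂ C₂ C₁ hA₁ hA₂ hC₂ hC₁ h₁₂ h₂₁ hA hC.symm
            ha₄ ha₁ ha₃ ha₂ hp₁ hp₂ hp₃ he₂ he₃ he₁ he₄ hp'₁ hp'₂ hp'₃
            (by rintro rfl; exact hnb p ⟨hp'₁, hp₂, hp₁, hp'₂⟩) u cols hu hU_M hcols
      · rcases hce with ⟨c, hc₁, hc₂, hc₃, hc₄⟩ | ⟨e, he₁, he₂, he₃, he₄⟩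
        · obtain ⟨p, hp₁, hp₂, hp₃⟩ := exists_path_node_ne hA₂ hC₁ h₂₁ d
          obtain ⟨p', hp'₁, hp'₂, hp'₃⟩ := exists_path_node_ne hA₁ hC₂ h₁₂ c
          exact exists_table_secondShell_twoTops h t A₂ A₁ C₁ C₂ hA₂ hA₁ hC₁ hC₂ h₂₁ h₁₂ hA.symm hC
            hd₂ hd₃ hd₁ hd₄ hp₁ hp₂ hp₃ hc₄ hc₁ hc₃ hc₂ hp'₁ hp'₂ hp'₃
            (by rintro rfl; exact hnb p ⟨hp₁, hp'₂, hp'₁, hp₂⟩) u cols hu hU_SM hcols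
        · obtain ⟨p, hp₁, hp₂, hp₃⟩ := exists_path_node_ne hA₁ hC₁ h₁₁ d
          obtain ⟨p', hp'₁, hp'₂, hp'₃⟩ := exists_path_node_ne hA₂ hC₂ h₂₂ e
          exact exists_table_secondShell_twoTops h t A₁ A₂ C₁ C₂ hA₁ hA₂ hC₁ hC₂ h₁₁ h₂₂ hA hC
            hd₂ hd₁ hd₃ hd₄ hp₁ hp₂ hp₃ he₄ he₃ he₁ he₂ hp'₁ hp'₂ hp'₃
            (by rintro rfl; exact hnb p ⟨hp₁, hp₂, hp'₁, hp'₂⟩) u cols hu hU hcols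
    · by_cases had : (∃ a, a ∉ A₁ ∧ a ∉ C₁ ∧ a ∉ A₂ ∧ a ∈ C₂) ∨ (∃ d, d ∉ A₁ ∧ d ∈ C₁ ∧ d ∉ A₂ ∧ d ∉ C₂)
      · -- no `c`, no `e`: the path of swap 1 avoids `A₂ ∪ C₂`, and `vx` is a dead attachment ⇒ unfed chain 1
        have hnc : ∀ v, ¬ (v ∉ A₁ ∧ v ∈ C₁ ∧ v ∈ A₂ ∧ v ∈ C₂) := fun v hv => htt ⟨had, Or.inl ⟨v, hv⟩⟩
        have hne : ∀ v, ¬ (v ∈ A₁ ∧ v ∈ C₁ ∧ v ∉ A₂ ∧ v ∈ C₂) := fun v hv => htt ⟨had, Or.inr ⟨v, hv⟩⟩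
        have hY : ∀ v ∈ C₁ \ A₁, v ∉ A₂ ∧ v ∉ C₂ := by
          intro v hv
          rw [Finset.mem_sdiff] at hv
          have hvA₂ : v ∉ A₂ := fun h' => by
            by_cases hvC₂ : v ∈ C₂
            · exact hnc v ⟨hv.2, hv.1, h', hvC₂⟩
            · exact hP' v h' hv.1 hv.2 hvC₂
          exact ⟨hvA₂, fun h' => hnb v ⟨hv.1, hv.2, h', hvA₂⟩⟩
        have hxC₂ : vx ∉ C₂ := fun h' => by
          by_cases hxC₁ : vx ∈ C₁
          · exact hne vx ⟨hvx₁, hxC₁, hvx₂, h'⟩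
          · exact hQ' vx hvx₁ h' hvx₂ hxC₁
        have hxC₁ : vx ∉ C₁ := fun h' => hCT₂' vx hvx₁ h' hvx₂ hxC₂
        exact exists_table_secondShell_unfed₁ h t A₁ A₂ C₁ C₂ hA₁ hA₂ hC₁ hC₂ h₁₁ h₂₂ hA hC hY hvx₁ hxC₁ hvx₂ hxC₂
          u cols hu hU hcols
      · -- no `a`, no `d`: the path of swap 2 lies in `A₁ ∩ C₁`, and `vd` is an attachment of type 1110 ⇒ unfed chain 2
        have hna : ∀ v, ¬ (v ∉ A₁ ∧ v ∉ C₁ ∧ v ∉ A₂ ∧ v ∈ C₂) := fun v hv => had (Or.inl ⟨v, hv⟩)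
        have hnd : ∀ v, ¬ (v ∉ A₁ ∧ v ∈ C₁ ∧ v ∉ A₂ ∧ v ∉ C₂) := fun v hv => had (Or.inr ⟨v, hv⟩)
        have hY : ∀ v ∈ C₂ \ A₂, v ∈ A₁ ∧ v ∈ C₁ := by
          intro v hv
          rw [Finset.mem_sdiff] at hv
          have hvA₁ : v ∈ A₁ := by
            by_contra h'
            by_cases hvC₁ : v ∈ C₁
            · exact hnb v ⟨hvC₁, h', hv.1, hv.2⟩
            · exact hna v ⟨h', hvC₁, hv.2, hv.1⟩
          refine ⟨hvA₁, ?_⟩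
          by_contra h'
          exact hQ' v hvA₁ hv.1 hv.2 h'
        have hdA₁ : vd ∈ A₁ := by
          by_contra h'
          by_cases hdA₂ : vd ∈ A₂
          · exact hP' vd hdA₂ hvd₁ h' hvd₂
          · exact hnd vd ⟨h', hvd₁, hdA₂, hvd₂⟩
        have hdA₂ : vd ∈ A₂ := by
          by_contra h'
          exact hCT₂' vd hdA₁ hvd₁ h' hvd₂
        exact exists_table_secondShell_unfed₂ h t A₁ A₂ C₁ C₂ hA₁ hA₂ hC₁ hC₂ h₁₁ h₂₂ hA hC hY hdA₂ hvd₂ hdA₁ hvd₁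
          u cols hu hU hcols

end SecondShell

end

end Summit.ValiantsHypothesis.ValiantsHypothesis.Theorems.BarrierLever.HiddenStates
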